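import Summits.CriticalPhenomena.PercolationContinuityZ3.Theorems.Transplant.PlanarCellsSep
import Summits.CriticalPhenomena.PercolationContinuityZ3.Theorems.Transplant.PlanarCellsPSep2
import HarnessLib

/-!
# Kozma–Nitzan's planar cells in `ℤ²`, part 5: the planar data of the ENTRY-SEED STAR scheme (design v3′, lead V51 / ENTRY-SEED-STAR.md §1, §4;
# p2-g2 KIT3-SIGNATURE.md `StarGeom`): cores `K_v`, arrival slabs `A^δ_v`, their inner face and `N` strips, corridors, the star, the entry step

builds on p205010 (kernel theorem, internal audit signed; external expert review pending) — nothing in this file uses p205010.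
Lane `prim-bschramm`, seat `prim-bschramm-p3` (lead 12:43Z: "p3-g2: planar A/K/strips/corridors"); helper file (`--supports stmt-CriticalPhenomena-4575 --as helper`).

With `r = K s` and `cen v = 20 r v` as in `PlanarCellsDefs` (all sets inside KN's cube `Q_v = cen v + [-5r, 5r]²` or between-box):
* `Core v := cen v + [-4r, 4r]²` (the core `K_v`; named `Core` because `C.K` is KN's level count);
* `Slab v δ` — the arrival slab of `v` on its `δ`-side: axis-`δ` level `∈ [4r+1, 5r]`, transverse `|·| ≤ 4r` (so the four slabs are pairwise
  disjoint and disjoint from the core; `A^{(x)}_v = Slab v δ` for `x = v + δ`);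
* `SlabFace v δ` — its inner face (level `= 4r+1`, adjacent to the core); `Strip v δ N i` (`i < N`) — `N` disjoint consecutive transverse segments
  of length `⌊(8r+1)/N⌋` of the inner face;
* `Cor v δ` — the corridor from the core's `δ`-face to the arrival slab of `v + δ` on its `rev δ`-side: levels `[4r+1, 15r-1]`, transverse `|·| ≤ 2r`;
* `Star v ons := Core v ∪ ⋃_{δ ∈ ons} (Cor v δ ∪ Slab (v + δ) (rev δ))`; the entry step `t ↦ t + stepVec δ`.
Facts: membership; `Core/Slab ⊆ Q`, `Cor ⊆ Q ∪ Btw`, `SlabFace ⊆ Slab`, `Strip ⊆ SlabFace`, strips disjoint and nonempty (`N ≤ 8r+1`), `Core ∩ Slab = ∅`,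
slabs of different sides disjoint, `cen v ∈ Core v`, the entry step maps `SlabFace (v+δ) (rev δ)` into `Core (v+δ)` along a `ℤ²`-edge, `Slab (v+δ) (rev δ)`
in `v`-coordinates (levels `[15r, 16r-1]`), and **`Core_disjoint_Star`**: `Core v' ∩ Star v ons = ∅` for `v' ≠ v` (the freshness of an unexamined core).

[cite: KozmaNitzan2024, §4 pp. 25–26 (Q_v, E_{v,x}) — the ℤ^d model; the slab/strip/star layout is this programme's (ENTRY-SEED-STAR.md)]
-/

noncomputable section

namespace Summit.CriticalPhenomena.PercolationContinuityZ3.Theorems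

namespace Transplant

open Literature.Probability.Percolation Literature.Probability.LatticeModels SimpleGraph GadgetSystem Contour
open Literature.Probability.Percolation.KozmaNitzan
open Literature.Probability.Percolation.KozmaNitzan.Cells (oth oth_ne sgOf sgOf_sign stepVec_apply_fst stepVec_apply_oth eq_oth_of_ne oth_oth
  eq_of_coords)

namespace PCells

variable (C : PCells)

/-! ## Definitions -/

/-- **The core** `K_v = cen v + [-4r, 4r]²`. [cite: KozmaNitzan2024, §4 p. 25 (Q_v)] -/
def Core (v : Site 2) : Finset (Site 2) := Finset.Icc (C.cen v - ((4 * C.r : ℕ) : Site 2)) (C.cen v + ((4 * C.r : ℕ) : Site 2))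

/-- **The arrival slab** of `v` on its `δ`-side: levels `[4r+1, 5r]` along `δ`, transverse half-width `4r`. -/
def Slab (v : Site 2) (δ : MDir) : Finset (Site 2) := sBox δ.1 (sgOf δ) (C.cen v) (4 * C.r + 1) (5 * C.r) (4 * C.r)

/-- **The inner face of the arrival slab** (level `4r+1`, adjacent to the core). -/
def SlabFace (v : Site 2) (δ : MDir) : Finset (Site 2) := sBox δ.1 (sgOf δ) (C.cen v) (4 * C.r + 1) (4 * C.r + 1) (4 * C.r)

/-- The strip length `⌊(8r+1)/N⌋`. -/
def sLen (N : ℕ) : ℕ := (8 * C.r + 1) / N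

/-- **The `i`-th strip** of the inner face (`i < N`): transverse offset from `cen v - 4r` in `[i L, (i+1) L - 1]`, `L = sLen N`. -/
def Strip (v : Site 2) (δ : MDir) (N i : ℕ) : Finset (Site 2) :=
  (C.SlabFace v δ).filter fun t =>
    C.cen v (oth δ.1) - 4 * C.r + i * C.sLen N ≤ t (oth δ.1) ∧ t (oth δ.1) + 1 ≤ C.cen v (oth δ.1) - 4 * C.r + (i + 1) * C.sLen N

/-- **The corridor** from the core's `δ`-face to the arrival slab of `v + δ`: levels `[4r+1, 15r-1]`, transverse half-width `2r`.
[cite: KozmaNitzan2024, §4 p. 25 (E_{v,x})] -/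
def Cor (v : Site 2) (δ : MDir) : Finset (Site 2) := sBox δ.1 (sgOf δ) (C.cen v) (4 * C.r + 1) (15 * C.r - 1) (2 * C.r)

/-- **The star** of `v` with onward directions `ons`: core, and for each onward `δ` the corridor and the arrival slab of `v + δ` facing `v`. -/
def Star (v : Site 2) (ons : Finset MDir) : Finset (Site 2) :=
  C.Core v ∪ ons.biUnion fun δ => C.Cor v δ ∪ C.Slab (v + stepVec δ) (rev δ)

/-! ## Membership -/

/-- Membership in the core. [folklore] -/
theorem mem_Core_iff {v t : Site 2} : t ∈ C.Core v ↔ ∀ i, C.cen v i - 4 * C.r ≤ t i ∧ t i ≤ C.cen v i + 4 * C.r := by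
  rw [Core, C.mem_sq_iff]; push_cast; exact Iff.rfl

/-- Membership in the arrival slab. [folklore] -/
theorem mem_Slab_iff {v : Site 2} {δ : MDir} {t : Site 2} :
    t ∈ C.Slab v δ ↔ (4 * (C.r : ℤ) + 1 ≤ sgOf δ * (t δ.1 - C.cen v δ.1) ∧ sgOf δ * (t δ.1 - C.cen v δ.1) ≤ 5 * C.r) ∧
      (C.cen v (oth δ.1) - 4 * C.r ≤ t (oth δ.1) ∧ t (oth δ.1) ≤ C.cen v (oth δ.1) + 4 * C.r) := by
  rw [Slab, mem_psBox_iff]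

/-- Membership in the inner face. [folklore] -/
theorem mem_SlabFace_iff {v : Site 2} {δ : MDir} {t : Site 2} :
    t ∈ C.SlabFace v δ ↔ sgOf δ * (t δ.1 - C.cen v δ.1) = 4 * C.r + 1 ∧
      (C.cen v (oth δ.1) - 4 * C.r ≤ t (oth δ.1) ∧ t (oth δ.1) ≤ C.cen v (oth δ.1) + 4 * C.r) := by
  rw [SlabFace, mem_psBox_iff]
  exact ⟨fun ⟨⟨h1, h2⟩, h3⟩ => ⟨le_antisymm h2 h1, h3⟩, fun ⟨h1, h3⟩ => ⟨⟨h1.ge, h1.le⟩, h3⟩⟩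

/-- Membership in a strip. [folklore] -/
theorem mem_Strip_iff {v : Site 2} {δ : MDir} {N i : ℕ} {t : Site 2} :
    t ∈ C.Strip v δ N i ↔ t ∈ C.SlabFace v δ ∧ C.cen v (oth δ.1) - 4 * C.r + i * C.sLen N ≤ t (oth δ.1) ∧
      t (oth δ.1) + 1 ≤ C.cen v (oth δ.1) - 4 * C.r + (i + 1) * C.sLen N := by
  rw [Strip, Finset.mem_filter]

/-- Membership in the corridor. [folklore] -/
theorem mem_Cor_iff {v : Site 2} {δ : MDir} {t : Site 2} :
    t ∈ C.Cor v δ ↔ (4 * (C.r : ℤ) + 1 ≤ sgOf δ * (t δ.1 - C.cen v δ.1) ∧ sgOf δ * (t δ.1 - C.cen v δ.1) ≤ 15 * C.r - 1) ∧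
      (C.cen v (oth δ.1) - 2 * C.r ≤ t (oth δ.1) ∧ t (oth δ.1) ≤ C.cen v (oth δ.1) + 2 * C.r) := by
  rw [Cor, mem_psBox_iff]

/-- Membership in the star. [folklore] -/
theorem mem_Star_iff {v : Site 2} {ons : Finset MDir} {t : Site 2} :
    t ∈ C.Star v ons ↔ t ∈ C.Core v ∨ ∃ δ ∈ ons, t ∈ C.Cor v δ ∨ t ∈ C.Slab (v + stepVec δ) (rev δ) := by
  simp only [Star, Finset.mem_union, Finset.mem_biUnion]

/-- **The arrival slab of `v + δ` facing `v`, in `v`-coordinates**: levels `[15r, 16r-1]` along `δ`, transverse `|·| ≤ 4r`. [folklore] -/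
theorem mem_Slab_add_iff {v : Site 2} {δ : MDir} {t : Site 2} :
    t ∈ C.Slab (v + stepVec δ) (rev δ) ↔ (15 * (C.r : ℤ) ≤ sgOf δ * (t δ.1 - C.cen v δ.1) ∧ sgOf δ * (t δ.1 - C.cen v δ.1) ≤ 16 * C.r - 1) ∧
      (C.cen v (oth δ.1) - 4 * C.r ≤ t (oth δ.1) ∧ t (oth δ.1) ≤ C.cen v (oth δ.1) + 4 * C.r) := by
  rw [mem_Slab_iff, show (rev δ).1 = δ.1 from rfl, Cells.sgOf_rev, C.cen_add_stepVec_fst, C.cen_add_stepVec_oth]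
  rcases sgOf_sign δ with hs | hs <;> rw [hs] <;> constructor <;> rintro ⟨⟨h1, h2⟩, h3⟩ <;> exact ⟨⟨by linarith, by linarith⟩, h3⟩

/-! ## Containments -/

/-- `Core_v ⊆ Q_v`. [folklore] -/
theorem Core_subset_Q (v : Site 2) : C.Core v ⊆ C.Q v := by
  intro t ht
  rw [mem_Core_iff] at ht
  rw [Q, C.mem_sq_iff]; intro i; push_cast; have := ht i; constructor <;> omega

/-- `cen v ∈ Core_v`. [folklore] -/
theorem cen_mem_Core (v : Site 2) : C.cen v ∈ C.Core v := by
  rw [mem_Core_iff]; intro i; constructor <;> omega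

/-- The arrival slab lies in the cube. [folklore] -/
theorem Slab_subset_Q (v : Site 2) (δ : MDir) : C.Slab v δ ⊆ C.Q v := by
  intro t ht
  rw [mem_Slab_iff] at ht
  obtain ⟨⟨h1, h2⟩, h3, h4⟩ := ht
  rw [Q, C.mem_sq_iff]; intro i; push_cast
  by_cases hi : i = δ.1
  · subst hi; rcases sgOf_sign δ with hs | hs <;> rw [hs] at h1 h2 <;> constructor <;> linarith
  · rw [eq_oth_of_ne hi]; constructor <;> omega

/-- The inner face lies in the slab. [folklore] -/
theorem SlabFace_subset_Slab (v : Site 2) (δ : MDir) : C.SlabFace v δ ⊆ C.Slab v δ := by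
  intro t ht
  rw [mem_SlabFace_iff] at ht
  rw [mem_Slab_iff]
  have hr : (1 : ℤ) ≤ C.r := by exact_mod_cast C.one_le_r
  exact ⟨⟨ht.1.ge, by linarith [ht.1.le]⟩, ht.2⟩

/-- A strip lies in the inner face. [folklore] -/
theorem Strip_subset_SlabFace (v : Site 2) (δ : MDir) (N i : ℕ) : C.Strip v δ N i ⊆ C.SlabFace v δ := Finset.filter_subset _ _

/-- The corridor lies in `Q_v ∪ Btw_{v,δ}`. [folklore] -/
theorem Cor_subset_Q_union_Btw (v : Site 2) (δ : MDir) : C.Cor v δ ⊆ C.Q v ∪ C.Btw v δ := by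
  intro t ht
  rw [mem_Cor_iff] at ht
  obtain ⟨⟨h1, h2⟩, h3, h4⟩ := ht
  rw [Finset.mem_union]
  by_cases hl : sgOf δ * (t δ.1 - C.cen v δ.1) ≤ 5 * C.r
  · left
    rw [Q, C.mem_sq_iff]; intro i; push_cast
    by_cases hi : i = δ.1
    · subst hi; rcases sgOf_sign δ with hs | hs <;> rw [hs] at h1 hl <;> constructor <;> linarith
    · rw [eq_oth_of_ne hi]; constructor <;> omega
  · right
    rw [Btw, mem_psBox_iff]
    exact ⟨⟨by omega, by omega⟩, by omega, by omega⟩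

/-- The star lies in `Q_v ∪ ⋃_δ (Btw_{v,δ} ∪ Q_{v+δ})` (KN's cube and between/next-cube regions). [folklore] -/
theorem Star_subset (v : Site 2) (ons : Finset MDir) :
    C.Star v ons ⊆ C.Q v ∪ Finset.univ.biUnion fun δ => C.Btw v δ ∪ C.Q (v + stepVec δ) := by
  intro t ht
  rw [mem_Star_iff] at ht
  rw [Finset.mem_union, Finset.mem_biUnion]
  rcases ht with ht | ⟨δ, -, ht | ht⟩
  · exact Or.inl (C.Core_subset_Q v ht)
  · rcases Finset.mem_union.1 (C.Cor_subset_Q_union_Btw v δ ht) with h | h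
    · exact Or.inl h
    · exact Or.inr ⟨δ, Finset.mem_univ _, Finset.mem_union_left _ h⟩
  · exact Or.inr ⟨δ, Finset.mem_univ _, Finset.mem_union_right _ (C.Slab_subset_Q _ _ ht)⟩

/-! ## Disjointness -/

/-- The core misses every arrival slab of the same cell. [folklore] -/
theorem Core_disjoint_Slab (v : Site 2) (δ : MDir) : Disjoint (C.Core v) (C.Slab v δ) := by
  rw [Finset.disjoint_left]
  intro t htK htA
  rw [mem_Core_iff] at htK
  rw [mem_Slab_iff] at htA
  obtain ⟨h1, h2⟩ := htK δ.1
  obtain ⟨⟨h3, -⟩, -⟩ := htA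
  rcases sgOf_sign δ with hs | hs <;> rw [hs] at h3 <;> linarith

/-- Arrival slabs of different sides of one cell are disjoint. [folklore] -/
theorem Slab_disjoint_Slab (v : Site 2) {δ δ' : MDir} (h : δ ≠ δ') : Disjoint (C.Slab v δ) (C.Slab v δ') := by
  rw [Finset.disjoint_left]
  intro t ht ht'
  rw [mem_Slab_iff] at ht ht'
  obtain ⟨⟨h1, h2⟩, h3, h4⟩ := ht
  obtain ⟨⟨h1', h2'⟩, h3', h4'⟩ := ht'
  by_cases ha : δ'.1 = δ.1
  · -- same axis, opposite signs
    have hσ : sgOf δ' ≠ sgOf δ := fun he => h (by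
      obtain ⟨a, b⟩ := δ; obtain ⟨a', b'⟩ := δ'
      simp only at ha; subst ha
      cases b <;> cases b' <;> first | rfl | (exfalso; revert he; unfold sgOf; simp))
    rw [ha] at h1'
    have hneg : sgOf δ' = -sgOf δ := by
      rcases sgOf_sign δ with hs | hs <;> rcases sgOf_sign δ' with hs' | hs' <;> rw [hs, hs'] <;> first | rfl | (exfalso; exact hσ (by rw [hs, hs']))
    rw [hneg] at h1'
    rcases sgOf_sign δ with hs | hs <;> rw [hs] at h1 h1' <;> linarith
  · -- orthogonal axes: `t δ'.1` is transverse for `δ`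
    have ho : δ'.1 = oth δ.1 := eq_oth_of_ne ha
    rw [ho] at h1'
    rcases sgOf_sign δ' with hs | hs <;> rw [hs] at h1' <;> linarith

/-- Cores of different cells are disjoint. [folklore] -/
theorem Core_disjoint_Core {u x : Site 2} (h : u ≠ x) : Disjoint (C.Core u) (C.Core x) :=
  (C.Q_disjoint_Q h).mono (C.Core_subset_Q u) (C.Core_subset_Q x)

/-- The core misses every corridor (own cell: levels `≥ 4r+1`; other cells: `Cor ⊆ Q ∪ Btw`). [folklore] -/
theorem Core_disjoint_Cor (x v : Site 2) (δ : MDir) : Disjoint (C.Core x) (C.Cor v δ) := by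
  rw [Finset.disjoint_left]
  intro t htK htC
  rcases Finset.mem_union.1 (C.Cor_subset_Q_union_Btw v δ htC) with hQ | hB
  · -- then `x = v` (cubes of different cells are disjoint) and the level is `≥ 4r+1`
    by_cases hxv : x = v
    · subst hxv
      rw [mem_Core_iff] at htK; rw [mem_Cor_iff] at htC
      obtain ⟨h1, h2⟩ := htK δ.1
      obtain ⟨⟨h3, -⟩, -⟩ := htC
      rcases sgOf_sign δ with hs | hs <;> rw [hs] at h3 <;> linarith
    · exact Finset.disjoint_left.1 (C.Q_disjoint_Q hxv) (C.Core_subset_Q x htK) hQ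
  · exact Finset.disjoint_left.1 (C.Q_disjoint_Btw x v δ) (C.Core_subset_Q x htK) hB

/-- **Freshness of an unexamined core**: the core of `x` misses the star of every other cell `v ≠ x`. [folklore] -/
theorem Core_disjoint_Star {x v : Site 2} (h : x ≠ v) (ons : Finset MDir) : Disjoint (C.Core x) (C.Star v ons) := by
  rw [Finset.disjoint_left]
  intro t htK htS
  rw [mem_Star_iff] at htS
  rcases htS with htS | ⟨δ, -, htS | htS⟩
  · exact Finset.disjoint_left.1 (C.Core_disjoint_Core h) htK htS
  · exact Finset.disjoint_left.1 (C.Core_disjoint_Cor x v δ) htK htS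
  · by_cases hx : x = v + stepVec δ
    · subst hx; exact Finset.disjoint_left.1 (C.Core_disjoint_Slab _ _) htK htS
    · exact Finset.disjoint_left.1 (C.Q_disjoint_Q hx) (C.Core_subset_Q x htK) (C.Slab_subset_Q _ _ htS)

/-- The centre of another cell is not in the star. [folklore] -/
theorem cen_not_mem_Star {x v : Site 2} (h : x ≠ v) (ons : Finset MDir) : C.cen x ∉ C.Star v ons := fun ht =>
  Finset.disjoint_left.1 (C.Core_disjoint_Star h ons) (C.cen_mem_Core x) ht

/-! ## Strips -/

/-- Strips with different indices are disjoint. [folklore] -/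
theorem Strip_disjoint_Strip (v : Site 2) (δ : MDir) (N : ℕ) {i i' : ℕ} (h : i ≠ i') : Disjoint (C.Strip v δ N i) (C.Strip v δ N i') := by
  rw [Finset.disjoint_left]
  intro t ht ht'
  rw [mem_Strip_iff] at ht ht'
  obtain ⟨-, h1, h2⟩ := ht
  obtain ⟨-, h1', h2'⟩ := ht'
  rcases lt_or_gt_of_ne h with hlt | hlt
  · have : ((i : ℤ) + 1) * C.sLen N ≤ (i' : ℤ) * C.sLen N := by
      have : (i : ℤ) + 1 ≤ i' := by exact_mod_cast hlt
      exact mul_le_mul_of_nonneg_right this (by positivity)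
    linarith
  · have : ((i' : ℤ) + 1) * C.sLen N ≤ (i : ℤ) * C.sLen N := by
      have : (i' : ℤ) + 1 ≤ i := by exact_mod_cast hlt
      exact mul_le_mul_of_nonneg_right this (by positivity)
    linarith

/-- **Strips are nonempty** when `1 ≤ N ≤ 8r + 1` and `i < N`: the point at transverse offset `i L` on the inner face. [folklore] -/
theorem Strip_nonempty (v : Site 2) (δ : MDir) {N i : ℕ} (hN : N ≤ 8 * C.r + 1) (hi : i < N) : (C.Strip v δ N i).Nonempty := by
  have hL : 1 ≤ C.sLen N := Nat.div_pos hN (by omega)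
  have hNL : N * C.sLen N ≤ 8 * C.r + 1 := by rw [mul_comm]; exact Nat.div_mul_le_self _ _
  have hiL : (i + 1) * C.sLen N ≤ 8 * C.r + 1 := (Nat.mul_le_mul_right _ (by omega : i + 1 ≤ N)).trans hNL
  -- the point: axis coordinate `cen + σ (4r+1)`, transverse `cen - 4r + i L`
  refine ⟨Function.update (Function.update (C.cen v) δ.1 (C.cen v δ.1 + sgOf δ * (4 * C.r + 1))) (oth δ.1)
    (C.cen v (oth δ.1) - 4 * C.r + i * C.sLen N), ?_⟩
  rw [mem_Strip_iff, mem_SlabFace_iff]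
  simp only [Function.update_self, Function.update_of_ne (oth_ne δ.1).symm, Function.update_self]
  refine ⟨⟨?_, ?_, ?_⟩, le_rfl, ?_⟩
  · rcases sgOf_sign δ with hs | hs <;> rw [hs] <;> ring
  · have : (0 : ℤ) ≤ i * C.sLen N := by positivity
    linarith
  · have h' : ((i : ℤ) + 1) * C.sLen N ≤ 8 * C.r + 1 := by exact_mod_cast hiL
    have h'' : (1 : ℤ) ≤ C.sLen N := by exact_mod_cast hL
    nlinarith
  · have h'' : (1 : ℤ) ≤ C.sLen N := by exact_mod_cast hL
    nlinarith

/-! ## The entry step -/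

/-- **The entry step** from the inner face of the arrival slab of `v + δ` (facing `v`) into the core of `v + δ`: `t ↦ t + stepVec δ` is a
`ℤ²`-edge landing in `Core (v + δ)`. [folklore] -/
theorem add_stepVec_mem_Core {v : Site 2} {δ : MDir} {t : Site 2} (ht : t ∈ C.SlabFace (v + stepVec δ) (rev δ)) :
    t + stepVec δ ∈ C.Core (v + stepVec δ) := by
  rw [mem_SlabFace_iff, show (rev δ).1 = δ.1 from rfl, Cells.sgOf_rev] at ht
  obtain ⟨h1, h2, h3⟩ := ht
  rw [mem_Core_iff]
  intro i
  by_cases hi : i = δ.1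
  · subst hi
    simp only [Pi.add_apply, stepVec_apply_fst]
    rcases sgOf_sign δ with hs | hs <;> rw [hs] at h1 ⊢ <;> constructor <;> linarith
  · rw [eq_oth_of_ne hi]
    simp only [Pi.add_apply, stepVec_apply_oth, add_zero]
    exact ⟨h2, h3⟩

/-- The entry step is a `ℤ²`-edge. [folklore] -/
theorem adj_add_stepVec (t : Site 2) (δ : MDir) : (zdGraph 2).Adj t (t + stepVec δ) :=
  (zdGraph_adj_iff_stepVec t _).2 ⟨δ, rfl⟩

end PCells

end Transplant

end Summit.CriticalPhenomena.PercolationContinuityZ3.Theorems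

end
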